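/-
Copyright (c) 2026 the pub-hodgecm-mathlib formalisation cell (harness21).  Prover seat hodgecm-mathlib-K2Liu-p09 (g6): Track B «K2-LIT»,
hLiu418 = stmt-HodgeConjecture-24832; LEAD F0P6-plan RULING M-158d «A7-val road (σ)», file V8a (the value MAP `ℳ_{K₀}` as a linear map on `I_v(½, χ_v)`).
-/
import Summits.HodgeConjecture.HodgeConjecture.Theorems.K2LiuA7ValueSiegelLaw   -- ★ V1d (`exists_flatFamily`, `value_siegel_mul`; brings ★ V1 `value_unique`, `value_eq_sum`, `value_translate`)
import HarnessLib

/-!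
# Crux `HLiu418`, road `K2_Liu`, organ A7-val, file V8a: THE VALUE MAP `ℳ_{K₀} : I_v(½, χ_v) → (H_v → ℂ)` OF THE NORMALISED INTERTWINING OPERATOR

Cell `hodgecm-mathlib`, crux item hLiu418 = `stmt-HodgeConjecture-24832`; squad K2 ∕ K2Liu; prover K2Liu-p09 (g6), organ lead A7-val.  THEOREMS ONLY; lane
`--supports stmt-HodgeConjecture-24832` (count-neutral helper).  RANK-GENERIC, frame-free, every finite place; HYPOTHESIS-FIRST in the (A4′-R) face
(`hA4R`, ★ B7 pays it at the CM datum) and in the half-plane integrability (`hintA`, ★ V1c pays it at `n = 2`).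
* §1 **`flatFamily_unique`** — two `K₀`-flat families of Siegel sections agreeing at one `s₁` agree everywhere (`H_v = P_Δ K₀`); right translates of
  (smooth) Siegel sections are (smooth) Siegel sections.
* §2 **`exists_valueMap`** — there is a `ℂ`-LINEAR map `ℳ : I_v(½, χ_v) →ₗ[ℂ] (H_v → ℂ)` (★ `localDegPS`) such that for EVERY `K₀`-flat family `f` of Siegel
  sections through `φ` with (A4′-R) datum `Fn` (`M_v(s)(f s) h = aNorm(s)·Fn s h` on `1 < re s`, `Fn(·) h` regular at `½`): **`ℳ φ h = Fn(½) h`** — the value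
  is a function of the section alone (§1 + ★ V1 `value_unique`), additive and homogeneous (★ V1 `value_eq_sum`).  No `def`: the map is delivered as `∃ ℳ, Spec ℳ`
  and §3 is stated for every `ℳ` satisfying the spec.
* §3 **the laws of any such `ℳ`**: `valueMap_translate` — `ℳ (φ(· u)) h = ℳ φ (h u)` (★ V1 `value_translate`); `valueMap_siegel` — `ℳ φ (p h) =
  χ′_{−½}(p) · ℳ φ h` for `p ∈ P_Δ(F_v)` (★ V1d `value_siegel_mul`; `χ′ = (χ ∘ c)⁻¹`); hence `φ ↦ ℳ φ 1` is an `H_v`-module map `I_v(½, χ_v) → I_v(−½, χ′_v)`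
  read at `1` — the `T_ℳ` of the (A4″-KR) assembly (file V8).
HONEST LABEL.  `HC_CM` is proved only modulo the 7 printed citations (2 remaining named inputs: hLiu418 = `stmt-HodgeConjecture-24832`,
h413 = `stmt-HodgeConjecture-24833`) until rung 0 closes.

## References
* [KudlaSweet1997] S. Kudla, W. J. Sweet, Israel J. Math. 98 (1997), §1 (standard sections, the normalised `M*(s)` and its value at `s₀`).
* [Casselman1980] W. Casselman, Compositio Math. 40 (1980), §3 (rationality of intertwining operators on flat sections).
* [HarrisKudlaSweet1996] M. Harris, S. Kudla, W. J. Sweet, J. AMS 9 (1996), §1 (1.11)–(1.15), §6 (6.14)–(6.16).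
-/

set_option autoImplicit false
set_option linter.dupNamespace false -- the mandated namespace repeats `HodgeConjecture.HodgeConjecture`

noncomputable section

open scoped Classical NNReal ENNReal
open NumberField IsDedekindDomain MeasureTheory Topology
open Literature.NumberTheory.GaloisRepresentations Literature.NumberTheory.GaloisRepresentations.IsNonarchimedeanLocalField
open Literature.NumberTheory.Automorphic Literature.NumberTheory.Automorphic.UnitaryGroup
open Literature.NumberTheory.GelbartRogawski1991.UnitaryDualPair.LocalSplitting
open Literature.NumberTheory.K2Lit.LocalSiegelDoubled
open Summit.HodgeConjecture.HodgeConjecture.Cruxes.HLiu418.K2LiuQRationalDefs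
open Summit.HodgeConjecture.HodgeConjecture.Cruxes.HLiu418.K2LiuLocalLFactorDefs
open Summit.HodgeConjecture.HodgeConjecture.Cruxes.HLiu418.K2LiuLocalSiegel
open Summit.HodgeConjecture.HodgeConjecture.Cruxes.HLiu418.K2LiuLocalIntertwiningProperty
open Summit.HodgeConjecture.HodgeConjecture.Cruxes.HLiu418.K2LiuFlatSiegelFamilies
open Summit.HodgeConjecture.HodgeConjecture.Cruxes.HLiu418.K2LiuA7ValueFunctional
open Summit.HodgeConjecture.HodgeConjecture.Cruxes.HLiu418.K2LiuA7ValueSiegelLaw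

namespace Summit.HodgeConjecture.HodgeConjecture.Cruxes.HLiu418.K2LiuA7ValueMap

variable (F : Type) [Field F] [NumberField F] (E : Type) [Field E] [NumberField E] [Algebra F E]
  [Algebra.IsQuadraticExtension F E] (c : E ≃ₐ[F] E)
  {δ : E} (hcδ : c δ = -δ) (hδ : δ ≠ 0) {d : F} (hd : δ * δ = algebraMap F E d) (v : HeightOneSpectrum (𝓞 F)) (n : ℕ)
  {T₀ : Matrix (Fin n) (Fin n) F} (hT₀ : T₀.IsSymm) {JD : Matrix (Fin (n + n)) (Fin (n + n)) E} (hJD : JD = (gramD F n T₀).map (algebraMap F E))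
  (χv : ∀ w : PlacesOver E v, (w.1.adicCompletion E)ˣ →* ℂˣ)

/-! ## §1 Flat families are determined by one member; translates of Siegel sections -/

section Flat

include hcδ hδ hd hT₀ hJD in
/-- **A `K₀`-FLAT FAMILY OF SIEGEL SECTIONS IS DETERMINED BY ONE MEMBER** (`H_v = P_Δ(F_v)·K₀`): `f s (p k) = χ_s(p) f s k = χ_s(p) f s₁ k`.
[cite: KudlaSweet1997, §1] [cite: Casselman1980, §3] -/
theorem flatFamily_unique (K₀ : Subgroup (UnitaryGroup.localPi E c (n + n) JD v))
    (hIw : ∀ x : UnitaryGroup.localPi E c (n + n) JD v, ∃ p, IsSiegelDelta F E c hcδ hδ hd v n hT₀ hJD p ∧ ∃ k ∈ K₀, x = p * k)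
    {f f' : ℂ → UnitaryGroup.localPi E c (n + n) JD v → ℂ}
    (hf : ∀ s, IsLocalSiegelSection F E c hcδ hδ hd v n hT₀ hJD χv s (f s)) (hf' : ∀ s, IsLocalSiegelSection F E c hcδ hδ hd v n hT₀ hJD χv s (f' s))
    (hflat : ∀ s s' : ℂ, ∀ k ∈ K₀, f s k = f s' k) (hflat' : ∀ s s' : ℂ, ∀ k ∈ K₀, f' s k = f' s' k) {s₁ : ℂ} (heq : f s₁ = f' s₁) (s : ℂ) :
    f s = f' s := by
  funext x
  obtain ⟨p, hp, k, hk, rfl⟩ := hIw x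
  rw [hf s p hp k, hf' s p hp k, hflat s s₁ k hk, hflat' s s₁ k hk, heq]

include hcδ hδ hd hT₀ hJD in
/-- right translates of Siegel sections are Siegel sections. [cite: HarrisKudlaSweet1996, §1 (1.15)] -/
theorem isLocalSiegelSection_comp_mul_right {s : ℂ} {φ : UnitaryGroup.localPi E c (n + n) JD v → ℂ}
    (hφ : IsLocalSiegelSection F E c hcδ hδ hd v n hT₀ hJD χv s φ) (u : UnitaryGroup.localPi E c (n + n) JD v) :
    IsLocalSiegelSection F E c hcδ hδ hd v n hT₀ hJD χv s fun x => φ (x * u) := fun p hp h => by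
  show φ (p * h * u) = localSiegelCharacter F E c v n χv s p * φ (h * u)
  rw [mul_assoc, hφ p hp (h * u)]

omit [Algebra.IsQuadraticExtension F E] in
/-- right translates of smooth functions are smooth (`U ↦ u U u⁻¹`). [cite: HarrisKudlaSweet1996, §1 (1.15)] -/
theorem isSmooth_comp_mul_right {φ : UnitaryGroup.localPi E c (n + n) JD v → ℂ} (hφ : IsSmooth F E c v n φ) (u : UnitaryGroup.localPi E c (n + n) JD v) :
    IsSmooth F E c v n fun x => φ (x * u) := by
  obtain ⟨U, hU⟩ := hφ
  have hcont : Continuous ((MulAut.conj u⁻¹).toMonoidHom : UnitaryGroup.localPi E c (n + n) JD v →* UnitaryGroup.localPi E c (n + n) JD v) :=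
    (continuous_const.mul continuous_id).mul continuous_const
  refine ⟨U.comap _ hcont, fun h w hw => ?_⟩
  have hw' : u⁻¹ * w * u⁻¹⁻¹ ∈ (U : Subgroup (UnitaryGroup.localPi E c (n + n) JD v)) := by
    simpa [OpenSubgroup.comap] using hw
  rw [inv_inv] at hw'
  show φ (h * w * u) = φ (h * u)
  rw [show h * w * u = h * u * (u⁻¹ * w * u) by group]
  exact hU (h * u) _ hw'

include hcδ hδ hd hT₀ hJD in
/-- right translation preserves `I_v(s, χ_v)`. [cite: HarrisKudlaSweet1996, §1 (1.15)] -/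
theorem comp_mul_right_mem_localDegPS {s : ℂ} {φ : UnitaryGroup.localPi E c (n + n) JD v → ℂ}
    (hφ : φ ∈ localDegPS F E c hcδ hδ hd v n hT₀ hJD χv s) (u : UnitaryGroup.localPi E c (n + n) JD v) :
    (fun x => φ (x * u)) ∈ localDegPS F E c hcδ hδ hd v n hT₀ hJD χv s :=
  ⟨isLocalSiegelSection_comp_mul_right F E c hcδ hδ hd v n hT₀ hJD χv hφ.1 u, isSmooth_comp_mul_right F E c v n hφ.2 u⟩

end Flat

/-! ## §2 The value map -/

section Value

variable [MeasurableSpace (unipDeltaLocal F E c v n (JD := JD))] (νN : Measure (unipDeltaLocal F E c v n (JD := JD))) (vol : ℝ)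
  (haN : ∀ s : ℂ, 1 < s.re → aNorm F E c v n χv vol s ≠ 0)
  (K₀ : Subgroup (UnitaryGroup.localPi E c (n + n) JD v))
  (hK₀ : IsCompact (K₀ : Set (UnitaryGroup.localPi E c (n + n) JD v)) ∧ IsOpen (K₀ : Set (UnitaryGroup.localPi E c (n + n) JD v)))
  (hIw : ∀ x : UnitaryGroup.localPi E c (n + n) JD v, ∃ p, IsSiegelDelta F E c hcδ hδ hd v n hT₀ hJD p ∧ ∃ k ∈ K₀, x = p * k)
  -- the (A4′-R) face in ∀∃-shape (★ B7) and the half-plane integrability (★ V1c at `n = 2`)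
  (hA4R : ∀ f' : ℂ → UnitaryGroup.localPi E c (n + n) JD v → ℂ, (∀ s, IsLocalSiegelSection F E c hcδ hδ hd v n hT₀ hJD χv s (f' s)) →
    (∀ s, IsSmooth F E c v n (f' s)) → (∀ s s' : ℂ, ∀ k ∈ K₀, f' s k = f' s' k) →
    ∃ Fn' : ℂ → UnitaryGroup.localPi E c (n + n) JD v → ℂ, (∀ h, IsQRationalRegularAt (residueFieldCard (v.adicCompletion F)) (1 / 2) fun s => Fn' s h) ∧
      ∀ s : ℂ, 1 < s.re → ∀ h, localIntertwining F E c v n hJD νN (f' s) h = aNorm F E c v n χv vol s * Fn' s h)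
  (hintA : ∀ f' : ℂ → UnitaryGroup.localPi E c (n + n) JD v → ℂ, (∀ s, IsLocalSiegelSection F E c hcδ hδ hd v n hT₀ hJD χv s (f' s)) →
    (∀ s, IsSmooth F E c v n (f' s)) → (∀ s s' : ℂ, ∀ k ∈ K₀, f' s k = f' s' k) → ∀ s : ℂ, 1 < s.re → ∀ h,
      Integrable (fun u : unipDeltaLocal F E c v n (JD := JD) => f' s (weylDelta F E c v n hJD * (u : UnitaryGroup.localPi E c (n + n) JD v) * h)) νN)

include hcδ hδ hd hT₀ hJD hK₀ hIw hA4R hintA haN in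
/-- **THE VALUE MAP.**  There is a `ℂ`-linear `ℳ : I_v(½, χ_v) →ₗ[ℂ] (H_v → ℂ)` such that for EVERY `K₀`-flat family `f` of smooth Siegel sections of `I_v(s, χ_v)`
through `φ = f(½)` with (A4′-R) datum `Fn` one has `ℳ φ h = Fn(½) h` for all `h`.  Well-definedness = §1 `flatFamily_unique` + ★ V1 `value_unique`;
linearity = ★ V1 `value_eq_sum` on the sum of the flat families. [cite: KudlaSweet1997, §1] [cite: Casselman1980, §3] -/
theorem exists_valueMap :
    ∃ ℳ : ↥(localDegPS F E c hcδ hδ hd v n hT₀ hJD χv (1 / 2)) →ₗ[ℂ] (UnitaryGroup.localPi E c (n + n) JD v → ℂ),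
      ∀ (φ : ↥(localDegPS F E c hcδ hδ hd v n hT₀ hJD χv (1 / 2))) (f Fn : ℂ → UnitaryGroup.localPi E c (n + n) JD v → ℂ),
        (∀ s, IsLocalSiegelSection F E c hcδ hδ hd v n hT₀ hJD χv s (f s)) → (∀ s, IsSmooth F E c v n (f s)) → (∀ s s' : ℂ, ∀ k ∈ K₀, f s k = f s' k) →
        f (1 / 2) = (φ : UnitaryGroup.localPi E c (n + n) JD v → ℂ) →
        (∀ h, IsQRationalRegularAt (residueFieldCard (v.adicCompletion F)) (1 / 2) fun s => Fn s h) →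
        (∀ s : ℂ, 1 < s.re → ∀ h, localIntertwining F E c v n hJD νN (f s) h = aNorm F E c v n χv vol s * Fn s h) →
        ∀ h, ℳ φ h = Fn (1 / 2) h := by
  -- the chosen flat family of a section and its (A4′-R) datum
  have hfam : ∀ φ : ↥(localDegPS F E c hcδ hδ hd v n hT₀ hJD χv (1 / 2)), ∃ f : ℂ → UnitaryGroup.localPi E c (n + n) JD v → ℂ,
      (∀ s, IsLocalSiegelSection F E c hcδ hδ hd v n hT₀ hJD χv s (f s)) ∧ (∀ s, IsSmooth F E c v n (f s)) ∧
        (∀ s s' : ℂ, ∀ k ∈ K₀, f s k = f s' k) ∧ f (1 / 2) = (φ : UnitaryGroup.localPi E c (n + n) JD v → ℂ) := fun φ =>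
    exists_flatFamily F E c hcδ hδ hd v n hT₀ hJD χv K₀ hK₀ hIw (1 / 2) φ.2.1 φ.2.2
  choose fφ hfS hfsm hffl hfthr using hfam
  choose Fφ hFreg hFfac using fun φ => hA4R (fφ φ) (hfS φ) (hfsm φ) (hffl φ)
  -- well-definedness: any admissible `(f, Fn)` through `φ` has `Fn(½) = Fφ φ (½)`
  have hwd : ∀ (φ : ↥(localDegPS F E c hcδ hδ hd v n hT₀ hJD χv (1 / 2))) (f Fn : ℂ → UnitaryGroup.localPi E c (n + n) JD v → ℂ),
      (∀ s, IsLocalSiegelSection F E c hcδ hδ hd v n hT₀ hJD χv s (f s)) → (∀ s, IsSmooth F E c v n (f s)) → (∀ s s' : ℂ, ∀ k ∈ K₀, f s k = f s' k) →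
      f (1 / 2) = (φ : UnitaryGroup.localPi E c (n + n) JD v → ℂ) →
      (∀ h, IsQRationalRegularAt (residueFieldCard (v.adicCompletion F)) (1 / 2) fun s => Fn s h) →
      (∀ s : ℂ, 1 < s.re → ∀ h, localIntertwining F E c v n hJD νN (f s) h = aNorm F E c v n χv vol s * Fn s h) →
      ∀ h, Fφ φ (1 / 2) h = Fn (1 / 2) h := by
    intro φ f Fn hS _ hfl hthr hreg hfac h
    have hff : f = fφ φ := funext (flatFamily_unique F E c hcδ hδ hd v n hT₀ hJD χv K₀ hIw hS (hfS φ) hfl (hffl φ) (hthr.trans (hfthr φ).symm))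
    subst hff
    exact value_unique F E c v n hJD νN χv vol haN (fφ φ) (Fφ φ) Fn h (hFreg φ h) (hreg h) (fun s hs => hFfac φ s hs h) (fun s hs => hfac s hs h)
  -- additivity and homogeneity via ★ V1 `value_eq_sum` on the sum ∕ multiple of the flat families
  have hadd : ∀ φ ψ : ↥(localDegPS F E c hcδ hδ hd v n hT₀ hJD χv (1 / 2)), (fun h => Fφ (φ + ψ) (1 / 2) h) = fun h => Fφ φ (1 / 2) h + Fφ ψ (1 / 2) h := by
    intro φ ψ
    funext h
    -- the family `fφ φ + fφ ψ` is admissible through `φ + ψ`, hence equals `fφ (φ + ψ)`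
    have hS : ∀ s, IsLocalSiegelSection F E c hcδ hδ hd v n hT₀ hJD χv s (fun x => fφ φ s x + fφ ψ s x) := fun s p hp x => by
      show fφ φ s (p * x) + fφ ψ s (p * x) = localSiegelCharacter F E c v n χv s p * (fφ φ s x + fφ ψ s x)
      rw [hfS φ s p hp x, hfS ψ s p hp x, mul_add]
    have hsm : ∀ s, IsSmooth F E c v n (fun x => fφ φ s x + fφ ψ s x) := fun s => IsSmooth.add F E c v n (hfsm φ s) (hfsm ψ s)
    have hfl : ∀ s s' : ℂ, ∀ k ∈ K₀, (fun x => fφ φ s x + fφ ψ s x) k = (fun x => fφ φ s' x + fφ ψ s' x) k := fun s s' k hk => by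
      show fφ φ s k + fφ ψ s k = fφ φ s' k + fφ ψ s' k
      rw [hffl φ s s' k hk, hffl ψ s s' k hk]
    have hthr : (fun x => fφ φ (1 / 2) x + fφ ψ (1 / 2) x) = ((φ + ψ : ↥(localDegPS F E c hcδ hδ hd v n hT₀ hJD χv (1 / 2))) :
        UnitaryGroup.localPi E c (n + n) JD v → ℂ) := by
      funext x
      rw [hfthr φ, hfthr ψ]
      rfl
    have hff : (fun s x => fφ φ s x + fφ ψ s x) = fφ (φ + ψ) :=
      funext (flatFamily_unique F E c hcδ hδ hd v n hT₀ hJD χv K₀ hIw hS (hfS (φ + ψ)) hfl (hffl (φ + ψ)) (hthr.trans (hfthr (φ + ψ)).symm))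
    have key := value_eq_sum F E c v n hJD νN χv vol haN (Finset.univ : Finset (Fin 2)) (fun _ _ => (1 : ℂ))
      (fun _ _ => isQRationalRegularAt_const _ _ (1 : ℂ)) (fun j => if j = 0 then fφ φ else fφ ψ) (fun j => if j = 0 then Fφ φ else Fφ ψ) h
      (fun j _ => by
        by_cases hj : j = 0
        · simp only [hj, if_true]; exact hFreg φ h
        · simp only [hj, if_false]; exact hFreg ψ h)
      (fun j _ s hs => by
        by_cases hj : j = 0
        · simp only [hj, if_true]; exact hFfac φ s hs h
        · simp only [hj, if_false]; exact hFfac ψ s hs h)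
      (fun j _ s hs => by
        by_cases hj : j = 0
        · simp only [hj, if_true]; exact hintA (fφ φ) (hfS φ) (hfsm φ) (hffl φ) s hs h
        · simp only [hj, if_false]; exact hintA (fφ ψ) (hfS ψ) (hfsm ψ) (hffl ψ) s hs h)
      (fφ (φ + ψ)) (fun s _ x => by
        rw [← hff, Fin.sum_univ_two]
        simp only [if_true, one_ne_zero, if_false, one_mul])
      (fun s => Fφ (φ + ψ) s h) (hFreg (φ + ψ) h) (hFfac (φ + ψ) · · h)
    rw [key, Fin.sum_univ_two]
    simp only [if_true, one_ne_zero, if_false, one_mul]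
  have hsmul : ∀ (a : ℂ) (φ : ↥(localDegPS F E c hcδ hδ hd v n hT₀ hJD χv (1 / 2))), (fun h => Fφ (a • φ) (1 / 2) h) = fun h => a * Fφ φ (1 / 2) h := by
    intro a φ
    funext h
    have hS : ∀ s, IsLocalSiegelSection F E c hcδ hδ hd v n hT₀ hJD χv s (fun x => a * fφ φ s x) := fun s p hp x => by
      show a * fφ φ s (p * x) = localSiegelCharacter F E c v n χv s p * (a * fφ φ s x)
      rw [hfS φ s p hp x]
      ring
    have hsm : ∀ s, IsSmooth F E c v n (fun x => a * fφ φ s x) := fun s => IsSmooth.smul F E c v n a (hfsm φ s)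
    have hfl : ∀ s s' : ℂ, ∀ k ∈ K₀, (fun x => a * fφ φ s x) k = (fun x => a * fφ φ s' x) k := fun s s' k hk => by
      show a * fφ φ s k = a * fφ φ s' k
      rw [hffl φ s s' k hk]
    have hthr : (fun x => a * fφ φ (1 / 2) x) = ((a • φ : ↥(localDegPS F E c hcδ hδ hd v n hT₀ hJD χv (1 / 2))) :
        UnitaryGroup.localPi E c (n + n) JD v → ℂ) := by
      funext x
      rw [hfthr φ]
      rfl
    have hff : (fun s x => a * fφ φ s x) = fφ (a • φ) :=
      funext (flatFamily_unique F E c hcδ hδ hd v n hT₀ hJD χv K₀ hIw hS (hfS (a • φ)) hfl (hffl (a • φ)) (hthr.trans (hfthr (a • φ)).symm))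
    have key := value_eq_sum F E c v n hJD νN χv vol haN (Finset.univ : Finset (Fin 1)) (fun _ _ => a)
      (fun _ _ => isQRationalRegularAt_const _ _ a) (fun _ => fφ φ) (fun _ => Fφ φ) h (fun _ _ => hFreg φ h) (fun _ _ s hs => hFfac φ s hs h)
      (fun _ _ s hs => hintA (fφ φ) (hfS φ) (hfsm φ) (hffl φ) s hs h)
      (fφ (a • φ)) (fun s _ x => by rw [← hff, Fin.sum_univ_one]) (fun s => Fφ (a • φ) s h) (hFreg (a • φ) h) (hFfac (a • φ) · · h)
    rw [key, Fin.sum_univ_one]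
  refine ⟨{ toFun := fun φ h => Fφ φ (1 / 2) h, map_add' := hadd, map_smul' := hsmul }, fun φ f Fn hS hsm hfl hthr hreg hfac h => ?_⟩
  exact hwd φ f Fn hS hsm hfl hthr hreg hfac h

end Value

/-! ## §3 The laws of the value map -/

section Laws

variable [MeasurableSpace (unipDeltaLocal F E c v n (JD := JD))] (νN : Measure (unipDeltaLocal F E c v n (JD := JD))) (vol : ℝ)
  (haN : ∀ s : ℂ, 1 < s.re → aNorm F E c v n χv vol s ≠ 0)
  (K₀ : Subgroup (UnitaryGroup.localPi E c (n + n) JD v))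
  (hK₀ : IsCompact (K₀ : Set (UnitaryGroup.localPi E c (n + n) JD v)) ∧ IsOpen (K₀ : Set (UnitaryGroup.localPi E c (n + n) JD v)))
  (hIw : ∀ x : UnitaryGroup.localPi E c (n + n) JD v, ∃ p, IsSiegelDelta F E c hcδ hδ hd v n hT₀ hJD p ∧ ∃ k ∈ K₀, x = p * k)
  (hA4R : ∀ f' : ℂ → UnitaryGroup.localPi E c (n + n) JD v → ℂ, (∀ s, IsLocalSiegelSection F E c hcδ hδ hd v n hT₀ hJD χv s (f' s)) →
    (∀ s, IsSmooth F E c v n (f' s)) → (∀ s s' : ℂ, ∀ k ∈ K₀, f' s k = f' s' k) →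
    ∃ Fn' : ℂ → UnitaryGroup.localPi E c (n + n) JD v → ℂ, (∀ h, IsQRationalRegularAt (residueFieldCard (v.adicCompletion F)) (1 / 2) fun s => Fn' s h) ∧
      ∀ s : ℂ, 1 < s.re → ∀ h, localIntertwining F E c v n hJD νN (f' s) h = aNorm F E c v n χv vol s * Fn' s h)
  (hintA : ∀ f' : ℂ → UnitaryGroup.localPi E c (n + n) JD v → ℂ, (∀ s, IsLocalSiegelSection F E c hcδ hδ hd v n hT₀ hJD χv s (f' s)) →
    (∀ s, IsSmooth F E c v n (f' s)) → (∀ s s' : ℂ, ∀ k ∈ K₀, f' s k = f' s' k) → ∀ s : ℂ, 1 < s.re → ∀ h,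
      Integrable (fun u : unipDeltaLocal F E c v n (JD := JD) => f' s (weylDelta F E c v n hJD * (u : UnitaryGroup.localPi E c (n + n) JD v) * h)) νN)
  -- a value map (§2 `exists_valueMap`)
  (ℳ : ↥(localDegPS F E c hcδ hδ hd v n hT₀ hJD χv (1 / 2)) →ₗ[ℂ] (UnitaryGroup.localPi E c (n + n) JD v → ℂ))
  (hℳ : ∀ (φ : ↥(localDegPS F E c hcδ hδ hd v n hT₀ hJD χv (1 / 2))) (f Fn : ℂ → UnitaryGroup.localPi E c (n + n) JD v → ℂ),
    (∀ s, IsLocalSiegelSection F E c hcδ hδ hd v n hT₀ hJD χv s (f s)) → (∀ s, IsSmooth F E c v n (f s)) → (∀ s s' : ℂ, ∀ k ∈ K₀, f s k = f s' k) →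
    f (1 / 2) = (φ : UnitaryGroup.localPi E c (n + n) JD v → ℂ) →
    (∀ h, IsQRationalRegularAt (residueFieldCard (v.adicCompletion F)) (1 / 2) fun s => Fn s h) →
    (∀ s : ℂ, 1 < s.re → ∀ h, localIntertwining F E c v n hJD νN (f s) h = aNorm F E c v n χv vol s * Fn s h) →
    ∀ h, ℳ φ h = Fn (1 / 2) h)

include hcδ hδ hd hT₀ hJD hK₀ hIw hA4R hintA haN hℳ in
/-- **TRANSLATION LAW**: `ℳ (φ(· u)) h = ℳ φ (h u)` — the value map commutes with right translations (★ V1 `value_translate` on the two flat families).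
[cite: KudlaSweet1997, §1] [cite: Casselman1980, §3] -/
theorem valueMap_translate (φ : ↥(localDegPS F E c hcδ hδ hd v n hT₀ hJD χv (1 / 2))) (u h : UnitaryGroup.localPi E c (n + n) JD v) :
    ℳ ⟨fun x => (φ : UnitaryGroup.localPi E c (n + n) JD v → ℂ) (x * u), comp_mul_right_mem_localDegPS F E c hcδ hδ hd v n hT₀ hJD χv φ.2 u⟩ h =
      ℳ φ (h * u) := by
  obtain ⟨f, hfS, hfsm, hffl, hfthr⟩ := exists_flatFamily F E c hcδ hδ hd v n hT₀ hJD χv K₀ hK₀ hIw (1 / 2) φ.2.1 φ.2.2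
  obtain ⟨Fn, hFreg, hFfac⟩ := hA4R f hfS hfsm hffl
  have hφu := comp_mul_right_mem_localDegPS F E c hcδ hδ hd v n hT₀ hJD χv φ.2 u
  obtain ⟨fg, hgS, hgsm, hgfl, hgthr⟩ := exists_flatFamily F E c hcδ hδ hd v n hT₀ hJD χv K₀ hK₀ hIw (1 / 2) hφu.1 hφu.2
  obtain ⟨Fng, hGreg, hGfac⟩ := hA4R fg hgS hgsm hgfl
  have hthrough : ∀ x, fg (1 / 2) x = f (1 / 2) (x * u) := fun x => by rw [hgthr, hfthr]
  rw [hℳ _ fg Fng hgS hgsm hgfl hgthr hGreg hGfac h, hℳ φ f Fn hfS hfsm hffl hfthr hFreg hFfac (h * u)]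
  exact value_translate F E c hcδ hδ hd v n hT₀ hJD νN χv vol haN K₀ hK₀ hIw hA4R hintA hfS hffl u hgS hgsm hgfl hthrough hFreg hFfac hGreg hGfac h

include hcδ hδ hd hT₀ hJD hK₀ hIw hA4R hintA haN hℳ in
/-- the same read at `h = 1`: `ℳ φ u = ℳ (φ(· u)) 1` — the value SECTION is recovered from the value FUNCTIONAL `φ ↦ ℳ φ 1`. [cite: KudlaSweet1997, §1] -/
theorem valueMap_apply_eq_valueMap_translate_one (φ : ↥(localDegPS F E c hcδ hδ hd v n hT₀ hJD χv (1 / 2))) (u : UnitaryGroup.localPi E c (n + n) JD v) :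
    ℳ φ u = ℳ ⟨fun x => (φ : UnitaryGroup.localPi E c (n + n) JD v → ℂ) (x * u), comp_mul_right_mem_localDegPS F E c hcδ hδ hd v n hT₀ hJD χv φ.2 u⟩ 1 := by
  rw [valueMap_translate F E c hcδ hδ hd v n hT₀ hJD χv νN vol haN K₀ hK₀ hIw hA4R hintA ℳ hℳ φ u 1, one_mul]

variable [BorelSpace (unipDeltaLocal F E c v n (JD := JD))] [νN.IsMulLeftInvariant]
  (hmod : ∀ (q' : UnitaryGroup.localPi E c (n + n) JD v) (hq : IsSiegelDelta F E c hcδ hδ hd v n hT₀ hJD q'),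
    Measure.map (fun u : unipDeltaLocal F E c v n (JD := JD) =>
      (⟨q' * (u : UnitaryGroup.localPi E c (n + n) JD v) * q'⁻¹, conj_mem_unipDeltaLocal F E c hcδ hδ hd v n hT₀ hJD hq u.2⟩ :
        unipDeltaLocal F E c v n (JD := JD))) νN =
      ENNReal.ofReal ((absDetDelta F E c v n q' ^ n)⁻¹) • νN)
  (χv' : ∀ w : PlacesOver E v, (w.1.adicCompletion E)ˣ →* ℂˣ)
  (hχ' : ∀ (w w' : PlacesOver E v) (h : c • w.1 = w'.1),
    χv' w = (χv w')⁻¹.comp (Units.map (galAdicCompletionMap (L := E) c h : w.1.adicCompletion E →* w'.1.adicCompletion E)))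
  (hT₀d : IsUnit T₀.det)

include hcδ hδ hd hT₀ hJD hK₀ hIw hA4R haN hℳ hmod hχ' hT₀d in
/-- **SIEGEL LAW OF THE VALUE SECTION**: `ℳ φ (p h) = χ′_{−½}(p) · ℳ φ h` for `p ∈ P_Δ(F_v)`, `χ′ = (χ ∘ c)⁻¹` (★ V1d `value_siegel_mul`) — `ℳ φ ∈ I_v(−½, χ′_v)`
as a function on `H_v`. [cite: KudlaSweet1997, §1] [cite: HarrisKudlaSweet1996, §1 (1.15)] -/
theorem valueMap_siegel (φ : ↥(localDegPS F E c hcδ hδ hd v n hT₀ hJD χv (1 / 2))) {p : UnitaryGroup.localPi E c (n + n) JD v}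
    (hp : IsSiegelDelta F E c hcδ hδ hd v n hT₀ hJD p) (h : UnitaryGroup.localPi E c (n + n) JD v) :
    ℳ φ (p * h) = localSiegelCharacter F E c v n χv' (-(1 / 2)) p * ℳ φ h := by
  obtain ⟨f, hfS, hfsm, hffl, hfthr⟩ := exists_flatFamily F E c hcδ hδ hd v n hT₀ hJD χv K₀ hK₀ hIw (1 / 2) φ.2.1 φ.2.2
  obtain ⟨Fn, hFreg, hFfac⟩ := hA4R f hfS hfsm hffl
  rw [hℳ φ f Fn hfS hfsm hffl hfthr hFreg hFfac (p * h), hℳ φ f Fn hfS hfsm hffl hfthr hFreg hFfac h]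
  exact value_siegel_mul F E c hcδ hδ hd v n hT₀ hJD χv νN hmod χv' hχ' vol haN hT₀d hfS hFreg hFfac hp h

include hcδ hδ hd hT₀ hJD hK₀ hIw hA4R haN hℳ hmod hχ' hT₀d in
/-- the value functional is invariant under right `N_Δ`-translation of the section read at `1`: `ℳ φ u = ℳ φ 1` for `u ∈ N_Δ(F_v)` (`χ′_{−½} = 1` on `N_Δ`).
[cite: HarrisKudlaSweet1996, §1 (1.15)] -/
theorem valueMap_apply_unipDelta (φ : ↥(localDegPS F E c hcδ hδ hd v n hT₀ hJD χv (1 / 2))) (u : unipDeltaLocal F E c v n (JD := JD)) :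
    ℳ φ (u : UnitaryGroup.localPi E c (n + n) JD v) = ℳ φ 1 := by
  have h := valueMap_siegel F E c hcδ hδ hd v n hT₀ hJD χv νN vol haN K₀ hK₀ hIw hA4R ℳ hℳ hmod χv' hχ' hT₀d φ
    (isSiegelDelta_of_mem_unipDeltaLocal F E c hcδ hδ hd v n hT₀ hJD u.2) 1
  rwa [mul_one, localSiegelCharacter_eq_one_of_mem_unipDeltaLocal F E c v n χv' (-(1 / 2)) u.2, one_mul] at h

end Laws

end Summit.HodgeConjecture.HodgeConjecture.Cruxes.HLiu418.K2LiuA7ValueMap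

end
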